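import Mathlib.RingTheory.Nullstellensatz
import Mathlib.RingTheory.AlgebraicIndependent.TranscendenceBasis
import Mathlib.LinearAlgebra.FiniteDimensional.Defs
import HarnessLib

/-!
# Transfer of varieties from an algebraically closed field to an algebraically closed subfield

Let `M ⊆ F` be fields (an `Algebra M F`), `M` algebraically closed, `P` a prime ideal of
`F[X_σ]` (`σ` finite) and `J = P ∩ M[X_σ]` its contraction. If the `M`-points of `J` are
`F`-points of `P` (which holds when `Z(P)` is cut out by polynomials with coefficients in `M`),
then `F` and the affine `M`-algebra `M[X]/J` are *linearly disjoint over `M`* inside `F[X]/P`: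
an `M`-algebraically independent family in `M[X]/J` stays `F`-algebraically independent in
`F[X]/P` (`algebraicIndependent_quotientMap`). The proof evaluates at `M`-points and expands the
coefficients of a would-be `F`-relation over an `M`-basis of their `M`-span (Hilbert's
Nullstellensatz over `M` identifies `J` with the polynomials vanishing on its `M`-points).

This is the algebraic input for transferring "irreducible of dimension `n`, rotund, free" from a
variety over the continuum model `F` to the countable chart `M` (Bays–Kirby 2018, proof of
Thm 8.2: axiom 4 is preserved under directed unions of closed embeddings).

## References

* M. Bays, J. Kirby, *Pseudo-exponential maps, variants, and quasiminimality*, Algebra & Number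
  Theory 12 (2018), Thm 8.2 (proof).
-/

noncomputable section

open MvPolynomial

namespace Literature.NumberTheory.Transcendental.ChartTransfer

variable {M F : Type*} [Field M] [Field F] [Algebra M F] {σ : Type*}

/-- The contraction `P ∩ M[X]` of an ideal of `F[X]` to the polynomials with coefficients in the
subfield `M`. [folklore] -/
def contract (P : Ideal (MvPolynomial σ F)) : Ideal (MvPolynomial σ M) :=
  P.comap (MvPolynomial.map (algebraMap M F))

/-- Membership in the contraction. [folklore] -/
theorem mem_contract_iff {P : Ideal (MvPolynomial σ F)} {q : MvPolynomial σ M} :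
    q ∈ contract P ↔ MvPolynomial.map (algebraMap M F) q ∈ P :=
  Ideal.mem_comap

/-- The contraction of a prime ideal is prime. [folklore] -/
instance contract_isPrime (P : Ideal (MvPolynomial σ F)) [P.IsPrime] : (contract (M := M) P).IsPrime :=
  Ideal.comap_isPrime _ _

/-- `F`-points of `P` are `F`-points of its contraction. [folklore] -/
theorem zeroLocus_subset_zeroLocus_contract (P : Ideal (MvPolynomial σ F)) :
    zeroLocus F P ⊆ zeroLocus F (contract (M := M) P) := by
  intro x hx q hq
  rw [← aeval_map_algebraMap F]
  exact hx _ (mem_contract_iff.1 hq)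

/-- Evaluating a polynomial with coefficients in `M` at the image of an `M`-point. [folklore] -/
theorem aeval_algebraMap_comp (m : σ → M) (q : MvPolynomial σ M) :
    aeval (algebraMap M F ∘ m) q = algebraMap M F (aeval m q) := by
  rw [← aeval_algebraMap_apply]

/-- `M[X] → F[X]` as an `M`-algebra map. [folklore] -/
abbrev mapₐ : MvPolynomial σ M →ₐ[M] MvPolynomial σ F := MvPolynomial.mapAlgHom (Algebra.ofId M F)

/-- `mapₐ` is `MvPolynomial.map (algebraMap M F)`. [folklore] -/
theorem mapₐ_apply (q : MvPolynomial σ M) : mapₐ (F := F) q = MvPolynomial.map (algebraMap M F) q :=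
  rfl

/-- The induced map on coordinate rings `M[X]/J → F[X]/P`, as an `M`-algebra map. [folklore] -/
def quotientMap (P : Ideal (MvPolynomial σ F)) :
    (MvPolynomial σ M ⧸ contract (M := M) P) →ₐ[M] MvPolynomial σ F ⧸ P :=
  Ideal.quotientMapₐ P mapₐ le_rfl

/-- `quotientMap` on classes. [folklore] -/
@[simp] theorem quotientMap_mk (P : Ideal (MvPolynomial σ F)) (q : MvPolynomial σ M) :
    quotientMap P (Ideal.Quotient.mk _ q) =
      Ideal.Quotient.mk P (MvPolynomial.map (algebraMap M F) q) :=
  rfl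

/-- `quotientMap` is injective. [folklore] -/
theorem quotientMap_injective (P : Ideal (MvPolynomial σ F)) :
    Function.Injective (quotientMap (M := M) P) :=
  Ideal.quotientMap_injective

/-- Polynomial identity: expanding the coefficients of `h ∈ F[T]` over a basis `e` of an
`M`-subspace of `F` containing them, `h = ∑ γ, C (e γ) * (h_γ mapped to F)`. [folklore] -/
theorem eq_sum_basis_mul_map {ι : Type*} {V : Submodule M F} {d : Type*} [Fintype d]
    (e : Module.Basis d M V) (h : MvPolynomial ι F) (hcoeff : ∀ β, h.coeff β ∈ V) :
    h = ∑ γ, C (e γ : F) * MvPolynomial.map (algebraMap M F)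
      (∑ β ∈ h.support, monomial β (e.repr ⟨h.coeff β, hcoeff β⟩ γ)) := by
  classical
  refine MvPolynomial.ext _ _ fun β => ?_
  have inner : ∀ γ, (∑ x ∈ h.support, coeff β (monomial x (e.repr ⟨h.coeff x, hcoeff x⟩ γ))) =
      if β ∈ h.support then e.repr ⟨h.coeff β, hcoeff β⟩ γ else 0 := by
    intro γ
    simp only [coeff_monomial]
    rw [Finset.sum_ite_eq']
  simp only [coeff_sum, coeff_C_mul, coeff_map, inner]
  by_cases hβ : β ∈ h.support
  · simp only [if_pos hβ]
    have key : (⟨h.coeff β, hcoeff β⟩ : V) = ∑ γ, e.repr ⟨h.coeff β, hcoeff β⟩ γ • e γ :=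
      (e.sum_repr _).symm
    have key' := congrArg (fun v : V => (v : F)) key
    simp only [Submodule.coe_sum, Submodule.coe_smul, Algebra.smul_def] at key'
    calc h.coeff β = ∑ x, (algebraMap M F) ((e.repr ⟨coeff β h, hcoeff β⟩) x) * ↑(e x) := key'
      _ = _ := Finset.sum_congr rfl fun γ _ => mul_comm _ _
  · simp only [if_neg hβ, map_zero, mul_zero, Finset.sum_const_zero]
    simpa [mem_support_iff] using hβ

variable [IsAlgClosed M] [Finite σ]

/-- **Linear disjointness of `F` and `M[X]/J` over `M`, pointwise.** If the `M`-points of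
`J = P ∩ M[X]` are `F`-points of `P`, then an `M`-algebraically independent family of `M[X]/J`
is `F`-algebraically independent in `F[X]/P`. [cite: BaysKirby2018ANT, Thm 8.2 (proof)] -/
theorem algebraicIndependent_quotientMap (P : Ideal (MvPolynomial σ F)) [P.IsPrime]
    (hpts : ∀ m : σ → M, m ∈ zeroLocus M (contract (M := M) P) →
      (algebraMap M F ∘ m) ∈ zeroLocus F P)
    {ι : Type*} {w : ι → MvPolynomial σ M ⧸ contract (M := M) P}
    (hw : AlgebraicIndependent M w) :
    AlgebraicIndependent F (quotientMap P ∘ w) := by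
  classical
  rw [algebraicIndependent_iff]
  intro h hh
  -- the `M`-span of the coefficients of `h` and an `M`-basis of it
  let V : Submodule M F := Submodule.span M (↑h.coeffs : Set F)
  have hcoeff : ∀ β, h.coeff β ∈ V := by
    intro β
    by_cases hβ : β ∈ h.support
    · exact Submodule.subset_span (Finset.mem_coe.2 (coeff_mem_coeffs β (mem_support_iff.1 hβ)))
    · have : h.coeff β = 0 := by simpa [mem_support_iff] using hβ
      rw [this]; exact V.zero_mem
  haveI : Module.Finite M V := Module.Finite.span_of_finite M h.coeffs.finite_toSet
  let e := Module.finBasis M V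
  -- the `M`-components of `h`
  let hc : Fin (Module.finrank M V) → MvPolynomial ι M := fun γ =>
    ∑ β ∈ h.support, monomial β (e.repr ⟨h.coeff β, hcoeff β⟩ γ)
  have hdec : h = ∑ γ, C (e γ : F) * MvPolynomial.map (algebraMap M F) (hc γ) :=
    eq_sum_basis_mul_map e h hcoeff
  -- representatives of `w` and of `aeval w (hc γ)`
  choose p hp using fun i => Ideal.Quotient.mk_surjective (w i)
  have hwp : w = (Ideal.Quotient.mkₐ M (contract (M := M) P)) ∘ p :=
    funext fun i => (hp i).symm
  let q : Fin (Module.finrank M V) → MvPolynomial σ M := fun γ => aeval p (hc γ)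
  have hq : ∀ γ, aeval w (hc γ) = Ideal.Quotient.mk (contract (M := M) P) (q γ) := by
    intro γ
    rw [hwp, show aeval ((Ideal.Quotient.mkₐ M (contract (M := M) P)) ∘ p) =
      (Ideal.Quotient.mkₐ M (contract (M := M) P)).comp (aeval p) from
        (MvPolynomial.comp_aeval p _).symm, AlgHom.comp_apply]
    rfl
  -- the relation in `F[X] ⧸ P`, and its lift `r ∈ P`
  let r : MvPolynomial σ F := ∑ γ, C (e γ : F) * MvPolynomial.map (algebraMap M F) (q γ)
  have haevalw : ∀ f : MvPolynomial ι M,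
      aeval (quotientMap P ∘ w) (MvPolynomial.map (algebraMap M F) f) =
        quotientMap P (aeval w f) := by
    intro f
    rw [aeval_map_algebraMap, show aeval (quotientMap P ∘ w) = (quotientMap P).comp (aeval w)
      from (MvPolynomial.comp_aeval w _).symm, AlgHom.comp_apply]
  have haeval : aeval (quotientMap P ∘ w) h = Ideal.Quotient.mk P r := by
    conv_lhs => rw [hdec]
    simp only [map_sum, map_mul, aeval_C, haevalw, hq, quotientMap_mk, r]
    refine Finset.sum_congr rfl fun γ _ => ?_
    rfl
  have hrP : r ∈ P := by
    rw [← Ideal.Quotient.eq_zero_iff_mem, ← haeval, hh]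
  -- evaluate at `M`-points: every `q γ` vanishes on `Z_M(J)`
  have hqJ : ∀ γ, q γ ∈ contract (M := M) P := by
    have hli : LinearIndependent M fun γ => (e γ : F) :=
      e.linearIndependent.map' V.subtype V.ker_subtype
    have hvan : ∀ γ, ∀ m ∈ zeroLocus M (contract (M := M) P), aeval m (q γ) = 0 := by
      intro γ m hm
      have hx := hpts m hm r hrP
      simp only [r, map_sum, map_mul, aeval_C, aeval_map_algebraMap, aeval_algebraMap_comp] at hx
      have hx' : ∑ γ, aeval m (q γ) • (e γ : F) = 0 := by
        rw [← hx]
        refine Finset.sum_congr rfl fun γ _ => ?_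
        rw [Algebra.smul_def, mul_comm]
        rfl
      exact Fintype.linearIndependent_iff.1 hli (fun γ => aeval m (q γ)) hx' γ
    intro γ
    have : q γ ∈ vanishingIdeal M (zeroLocus M (contract (M := M) P)) :=
      fun m hm => hvan γ m hm
    rwa [MvPolynomial.IsPrime.vanishingIdeal_zeroLocus (K := M) (contract (M := M) P)] at this
  -- hence every `hc γ` vanishes at `w`, so `hc γ = 0`, so `h = 0`
  have hc0 : ∀ γ, hc γ = 0 := by
    intro γ
    refine (algebraicIndependent_iff.1 hw) _ ?_
    rw [hq, Ideal.Quotient.eq_zero_iff_mem]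
    exact hqJ γ
  rw [hdec]
  refine Finset.sum_eq_zero fun γ _ => ?_
  rw [hc0 γ, map_zero, mul_zero]

/-! ### Equality of transcendence degrees -/

section Trdeg

universe u

variable {M F : Type u} [Field M] [Field F] [Algebra M F] {σ : Type*} [IsAlgClosed M] [Finite σ]

/-- `trdeg_M (M[X]/J) ≤ trdeg_F (F[X]/P)` under the point hypothesis (linear disjointness).
[cite: BaysKirby2018ANT, Thm 8.2 (proof)] -/
theorem trdeg_quotient_contract_le (P : Ideal (MvPolynomial σ F)) [P.IsPrime]
    (hpts : ∀ m : σ → M, m ∈ zeroLocus M (contract (M := M) P) →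
      (algebraMap M F ∘ m) ∈ zeroLocus F P) :
    Algebra.trdeg M (MvPolynomial σ M ⧸ contract (M := M) P) ≤
      Algebra.trdeg F (MvPolynomial σ F ⧸ P) := by
  unfold Algebra.trdeg
  refine ciSup_le' fun s => ?_
  exact (algebraicIndependent_quotientMap P hpts s.2).cardinalMk_le_trdeg

omit [IsAlgClosed M] [Finite σ] in
/-- `trdeg_F (F[X]/P) ≤ trdeg_M (M[X]/J)`: a transcendence basis of `F[X]/P` among the
coordinate functions is `M`-algebraically independent in `M[X]/J`. [folklore] -/
theorem trdeg_le_trdeg_quotient_contract (P : Ideal (MvPolynomial σ F)) [P.IsPrime] :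
    Algebra.trdeg F (MvPolynomial σ F ⧸ P) ≤
      Algebra.trdeg M (MvPolynomial σ M ⧸ contract (M := M) P) := by
  classical
  haveI : IsDomain (MvPolynomial σ F ⧸ P) := Ideal.Quotient.isDomain P
  haveI : @FaithfulSMul F (MvPolynomial σ F ⧸ P) Algebra.toSMul :=
    (faithfulSMul_iff_algebraMap_injective F _).mpr (algebraMap F _).injective
  -- the coordinate functions generate
  set xB : σ → MvPolynomial σ F ⧸ P := fun i => Ideal.Quotient.mk P (X i) with hxB
  have hadj : Algebra.adjoin F (Set.range xB) = ⊤ := by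
    have h1 : Algebra.adjoin F (Set.range xB) =
        (Algebra.adjoin F (Set.range (X : σ → MvPolynomial σ F))).map
          (Ideal.Quotient.mkₐ F P) := by
      rw [AlgHom.map_adjoin, ← Set.range_comp]; rfl
    rw [h1, MvPolynomial.adjoin_range_X, Algebra.map_top,
      (AlgHom.range_eq_top _).2 (Ideal.Quotient.mkₐ_surjective F P)]
  haveI : Algebra.IsAlgebraic (Algebra.adjoin F (Set.range xB)) (MvPolynomial σ F ⧸ P) :=
    ⟨fun b => by
      have hb : b ∈ Algebra.adjoin F (Set.range xB) := by rw [hadj]; exact Algebra.mem_top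
      exact isAlgebraic_algebraMap (⟨b, hb⟩ : Algebra.adjoin F (Set.range xB))⟩
  obtain ⟨t, hts, ht⟩ := exists_isTranscendenceBasis_subset (R := F) (Set.range xB)
  -- preimage indices
  have hpre : ∀ b : t, ∃ i : σ, xB i = b := fun b => hts b.2
  choose idx hidx using hpre
  -- the corresponding family in `M[X]/J` is `M`-algebraically independent
  let a : t → MvPolynomial σ M ⧸ contract (M := M) P :=
    fun b => Ideal.Quotient.mk _ (X (idx b))
  have hqa : quotientMap P ∘ a = ((↑) : t → MvPolynomial σ F ⧸ P) := by
    funext b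
    simp only [Function.comp_apply, a, quotientMap_mk, map_X]
    exact hidx b
  have ha : AlgebraicIndependent M a := by
    rw [algebraicIndependent_iff]
    intro g hg
    have h1 : quotientMap P (aeval a g) = 0 := by rw [hg, map_zero]
    rw [show quotientMap P (aeval a g) = aeval (quotientMap P ∘ a) g from
      ((MvPolynomial.comp_aeval a (quotientMap P)).symm ▸ rfl), hqa,
      ← aeval_map_algebraMap F] at h1
    have h2 := (algebraicIndependent_iff.1 ht.1) _ h1
    exact MvPolynomial.map_injective _ (algebraMap M F).injective (by rw [h2, map_zero])
  calc Algebra.trdeg F (MvPolynomial σ F ⧸ P) = Cardinal.mk t := ht.cardinalMk_eq_trdeg.symm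
    _ ≤ _ := ha.cardinalMk_le_trdeg

/-- **Equality of transcendence degrees** `trdeg_M (M[X]/(P ∩ M[X])) = trdeg_F (F[X]/P)` for a
prime `P` whose `M`-contraction has its `M`-points among the `F`-points of `P`
(`M` algebraically closed). [cite: BaysKirby2018ANT, Thm 8.2 (proof)] -/
theorem trdeg_quotient_contract_eq (P : Ideal (MvPolynomial σ F)) [P.IsPrime]
    (hpts : ∀ m : σ → M, m ∈ zeroLocus M (contract (M := M) P) →
      (algebraMap M F ∘ m) ∈ zeroLocus F P) :
    Algebra.trdeg M (MvPolynomial σ M ⧸ contract (M := M) P) =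
      Algebra.trdeg F (MvPolynomial σ F ⧸ P) :=
  le_antisymm (trdeg_quotient_contract_le P hpts) (trdeg_le_trdeg_quotient_contract P)

end Trdeg

end Literature.NumberTheory.Transcendental.ChartTransfer

end
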